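/-
COR-CM (cell pub-hodgecm2, stage 2 of the Hodge ladder) — count-neutral KERNEL COMBINATORICS «μ = φ₂ for EVERY finite 2-group with a cyclic subgroup
of index two and EVERY central involution — ONE theorem» (seat prover-pub-hodgecm2-b23-g50-0, binder prover b23, gen 50; own census lane INDEX-TWO
CYCLIC 2-GROUPS, claim HOME/INBOX.md l.23042; the capstone announced in gen 49ʼs design note `HOME/pub-hodgecm2-b23/INDEX-TWO-CYCLIC.md` §5).
Theorems only; the laws it assembles are used BY NAME: seat b23 gen 49 `Census/IndexTwoCyclicTwoPower.lean` (split side, every twist), gen 38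
`Census/CyclicFacesGenerate.lean` (cyclic), gen 40 `Census/ComplementFacesGenerate.lean` (complemented `c`), seat b09ʼs quaternion column through
`Census/IndexTwoCyclicQuaternion.lean` (this seat, via census invariance under group isomorphism `Census/GroupIsoTransport.lean`), and the
classification-free trichotomy `Census/IndexTwoCyclicNormalForm.lean` (this seat).  No definition, no `decide`, no certificate, no named fact, no `sorry`.
`Interfaces.lean` (C1), every E term, B01, `Transposition/*`, `PortJoin/*`, `D2Bridge/*` untouched.
HONEST FRAMING: `HC_CM` is NOT proved, here or anywhere in the tree; nothing here is a period, a count of record or a headline.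
T5: n/a-class (hypothesis binders: `|G| = 2ᵏ`, `k ≥ 3`, `(zpowers u).index = 2`, `c·c = 1`, `c ≠ 1`, `c` central — inhabited by `ℤ/8`; checker: self,
2026-08-25).
-/
import Summits.HodgeConjecture.CorCM.Census.IndexTwoCyclicTwoPower
import Summits.HodgeConjecture.CorCM.Census.IndexTwoCyclicQuaternion
import Summits.HodgeConjecture.CorCM.Census.IndexTwoCyclicNormalForm
import Summits.HodgeConjecture.CorCM.Census.CyclicFacesGenerate
import Summits.HodgeConjecture.CorCM.Census.ComplementFacesGenerate
import HarnessLib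

/-!
# The face census of every 2-group with a cyclic subgroup of index two: `μ(G, c) = φ₂(G, c)`

Let `G` be a finite group of order `2ᵏ ≥ 8` containing an element `u` with `[G : ⟨u⟩] = 2` (a cyclic maximal subgroup), and let `c ∈ G` be ANY
central involution.  By Burnsideʼs classification such a `G` is `ℤ/2ᵏ`, `ℤ/2^{k−1} × ℤ/2`, `D_{2ᵏ}`, `Q_{2ᵏ}`, `SD_{2ᵏ}` or `M_{2ᵏ}`; the face census of
each of these was a separate lane of this cell (seat b23 gens 38/48/49, seat b09ʼs twisted and quaternion columns, gen 40ʼs complement law).  THIS FILE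
states and proves the census for the whole class as ONE theorem over the abstract group, WITHOUT the classification:

* §1 `isLeast_card_gfaces_generate_fibreTwo_of_isCyclic` — gen 38ʼs cyclic law in `IsLeast` form (`μ = φ₂ = β − 1`).
* §2 **`isLeast_card_gfaces_generate_fibreTwo_of_two_group (hc2) (hc1) (hcen) (u) (hcard : |G| = 2ᵏ) (hk : 3 ≤ k) (hindex : [G : ⟨u⟩] = 2)`**:
  `IsLeast {|S| : S ⊆ gfaceSet, ℤ[G]·S + pairs ⊇ hodgeSpan} (φ₂(G, c))` — the least number of rank-four face relations whose base changes generate the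
  integer Hodge lattice of `(G, c)` modulo pairs is EXACTLY the coinvariant fibre dimension `φ₂(G, c)` (André-3ʼs floor is attained).
  PROOF MAP: `c ∉ ⟨u⟩` ⟹ `⟨u⟩` is a complement of `c` ⟹ gen 40 (`ComplementFaces.isLeast_card_gfaces_generate_fibreTwo_of_cpl`); `c ∈ ⟨u⟩` ⟹ `c = uⁿ`
  (`n = 2^{k−2}`) and the TRICHOTOMY of `Census/IndexTwoCyclicNormalForm.lean`: an involution outside `⟨u⟩` ⟹ gen 49ʼs 2-power capstone
  (`isLeast_card_gfaces_generate_fibreTwo_of_involution_two_pow`, every twist: `ℤ/2n × ℤ/2`, `D`, `SD`, `M`); `G` cyclic ⟹ §1; the quaternion relations ⟹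
  seat b09ʼs column transported (`isLeast_card_gfaces_generate_fibreTwo_of_quaternion`).
* §3 the same in `IsPGroup 2` form and in block currency `μ = β + d₂(G/𝒦) − 2` (lit-andre-3ʼs closed form `φ₂ + 2 = β + d₂`).

Census dictionary (INT-4 «what is known»; nothing here is a period): for every Galois CM field of 2-power degree `≥ 8` that is CYCLIC OVER A QUADRATIC
SUBFIELD, the Hodge ring of the whole CM slice is generated modulo divisor classes by the Galois conjugates of exactly `φ₂` rank-four face classes, and no
fewer Hodge generators of any kind exist modulo pairs — field level in `CorCM/FaceIndexTwoCyclicTwoGroups.lean`.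

## References
* [Pohlmann1968] H. Pohlmann, Algebraic cycles on abelian varieties of complex multiplication type, Ann. of Math. 88 (1968), Thm 1.
* [Rotman1995] J. J. Rotman, *An Introduction to the Theory of Groups*, 4th ed., GTM 148, Springer 1995, Thm. 5.46 (the classification NOT used here).
-/

namespace Summit.HodgeConjecture.CorCM.Census.IndexTwoCyclic

open Finset
open Summit.HodgeConjecture.CorCM.Prior.AllgGroup.RfwfAllgGroup
open Summit.HodgeConjecture.CorCM.Census.BlockParity
open Summit.HodgeConjecture.CorCM.Census.Coinvariant
open Summit.HodgeConjecture.CorCM.Census.TypeStabiliser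
open Summit.HodgeConjecture.CorCM.Census.IndexTwo

noncomputable section

variable {G : Type*} [Group G] [Fintype G] [DecidableEq G] {c : G} (hc2 : c * c = 1) (hc1 : c ≠ 1)

/-! ## §1 Cyclic groups, in `IsLeast` form -/

include hc1 in
/-- **`μ(G, c) = φ₂(G, c)` for every finite CYCLIC group and its involution `c ≠ 1`** — seat b23 gen 38ʼs cyclic law
(`Census/CyclicFacesGenerate.lean`, `μ = β − 1 = φ₂`) in least-element form. [folklore] -/
theorem isLeast_card_gfaces_generate_fibreTwo_of_isCyclic [IsCyclic G] :
    IsLeast {m : ℕ | ∃ S : Finset (CMF G c →₀ ℤ), ↑S ⊆ gfaceSet G c hc2 ∧ S.card = m ∧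
      hodgeSpan c hc2 ≤ Submodule.span ℤ (pairSet c) ⊔ Submodule.span ℤ (translates c S)} (fibreTwo c hc2) := by
  constructor
  · obtain ⟨S, hS, -, hφ, hgen⟩ := CyclicFaces.exists_gfaces_generate_of_isCyclic_card_eq c hc2 hc1
    exact ⟨S, hS, hφ.symm, hgen⟩
  · rintro m ⟨S, hS, rfl, hgen⟩
    exact fibreTwo_le_card_of_faces c hc2 (mul_comm_of_isCyclic c) S hS fun y hy => hgen (gfaceSet_subset_hodgeSpan c hc2 hy)

/-! ## §2 The capstone -/

include hc1 in
/-- **THE FACE CENSUS OF EVERY 2-GROUP WITH A CYCLIC SUBGROUP OF INDEX TWO: `μ(G, c) = φ₂(G, c)`.**  For a finite group `G` of order `2ᵏ ≥ 8`,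
an element `u` with `[G : ⟨u⟩] = 2`, and ANY central involution `c ≠ 1`: the least number of rank-four face relations whose base changes generate the
integer Hodge lattice of `(G, c)` modulo the pairs is EXACTLY `φ₂(G, c)`.  One theorem for `ℤ/2ᵏ`, `ℤ/2^{k−1} × ℤ/2` (all three central involutions),
`D_{2ᵏ}`, `Q_{2ᵏ}`, `SD_{2ᵏ}`, `M_{2ᵏ}` — proved WITHOUT the classification, through the trichotomy of `Census/IndexTwoCyclicNormalForm.lean`. [folklore] -/
theorem isLeast_card_gfaces_generate_fibreTwo_of_two_group (hcen : ∀ x : G, x * c = c * x) (u : G) {k : ℕ}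
    (hcard : Fintype.card G = 2 ^ k) (hk : 3 ≤ k) (hindex : (Subgroup.zpowers u).index = 2) :
    IsLeast {m : ℕ | ∃ S : Finset (CMF G c →₀ ℤ), ↑S ⊆ gfaceSet G c hc2 ∧ S.card = m ∧
      hodgeSpan c hc2 ≤ Submodule.span ℤ (pairSet c) ⊔ Submodule.span ℤ (translates c S)} (fibreTwo c hc2) := by
  have hord : orderOf u = 2 * 2 ^ (k - 2) :=
    orderOf_eq_of_card (by rw [Nat.card_eq_fintype_card, hcard]) (by omega) hindex
  by_cases hcu : c ∈ Subgroup.zpowers u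
  · -- `c = uⁿ`, `n = 2^{k-2} ≥ 2`: trichotomy
    have hun : u ^ 2 ^ (k - 2) = c := (eq_pow_of_mem_zpowers_of_mul_self hord hcu hc2 hc1).symm
    rcases exists_involution_or_isCyclic_or_quaternion u (n := 2 ^ (k - 2)) (a := k - 2) rfl hord hindex with
      ⟨w, hw, hww⟩ | hcyc | ⟨w, hw, hww, hwu⟩
    · -- split: an involution outside `⟨u⟩` (ℤ/2n × ℤ/2 with `c = (n,0)`, dihedral, semidihedral, modular)
      exact isLeast_card_gfaces_generate_fibreTwo_of_involution_two_pow hc2 hc1 u w rfl (by omega) hun hord hindex hw hww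
    · -- cyclic
      haveI : IsCyclic G := hcyc
      exact isLeast_card_gfaces_generate_fibreTwo_of_isCyclic hc2 hc1
    · -- generalised quaternion
      exact isLeast_card_gfaces_generate_fibreTwo_of_quaternion hc2 u w hun hord hindex hw (hww.trans hun) hwu
        (Nat.le_self_pow (by omega) 2)
  · -- `c ∉ ⟨u⟩`: `⟨u⟩` is a complement of `c` (ℤ/2n × ℤ/2 with `c = (0,1)` or `(n,1)`)
    exact ComplementFaces.isLeast_card_gfaces_generate_fibreTwo_of_cpl c (cpl_of_index_two c hindex hcu) hc2 hc1 hcen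

/-! ## §3 Variants: `IsPGroup 2`, and block currency -/

include hc1 in
/-- **`μ(G, c) = φ₂(G, c)` for every finite 2-group of order `≥ 8` with a cyclic subgroup of index two and every central involution `c`**
(`IsPGroup` form of §2). [folklore] -/
theorem isLeast_card_gfaces_generate_fibreTwo_of_isPGroup (hG : IsPGroup 2 G) (h8 : 8 ≤ Fintype.card G)
    (hcen : ∀ x : G, x * c = c * x) (u : G) (hindex : (Subgroup.zpowers u).index = 2) :
    IsLeast {m : ℕ | ∃ S : Finset (CMF G c →₀ ℤ), ↑S ⊆ gfaceSet G c hc2 ∧ S.card = m ∧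
      hodgeSpan c hc2 ≤ Submodule.span ℤ (pairSet c) ⊔ Submodule.span ℤ (translates c S)} (fibreTwo c hc2) := by
  obtain ⟨k, hk⟩ := IsPGroup.iff_card.mp hG
  rw [Nat.card_eq_fintype_card] at hk
  have hk3 : 3 ≤ k := by
    by_contra h
    push Not at h
    have : 2 ^ k ≤ 2 ^ 2 := Nat.pow_le_pow_right (by norm_num) (by omega)
    omega
  exact isLeast_card_gfaces_generate_fibreTwo_of_two_group hc2 hc1 hcen u hk hk3 hindex

include hc1 in
/-- **Block currency: `μ(G, c) = β(G, c) + d₂(G/𝒦) − 2`** for every 2-group of order `2ᵏ ≥ 8` with a cyclic subgroup of index two and every central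
involution `c` (lit-andre-3ʼs closed form `φ₂ + 2 = β + d₂`, `Census/TypeStabiliserCharK.lean`). [folklore] -/
theorem isLeast_card_gfaces_generate_of_two_group (hcen : ∀ x : G, x * c = c * x) (u : G) {k : ℕ}
    (hcard : Fintype.card G = 2 ^ k) (hk : 3 ≤ k) (hindex : (Subgroup.zpowers u).index = 2) :
    IsLeast {m : ℕ | ∃ S : Finset (CMF G c →₀ ℤ), ↑S ⊆ gfaceSet G c hc2 ∧ S.card = m ∧
      hodgeSpan c hc2 ≤ Submodule.span ℤ (pairSet c) ⊔ Submodule.span ℤ (translates c S)}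
      (Fintype.card (Block c) + indexTwoRank (stabGen c) - 2) := by
  have heven : Even (Fintype.card G / 2) := by
    obtain ⟨k', rfl⟩ : ∃ k', k = k' + 3 := ⟨k - 3, by omega⟩
    refine ⟨2 ^ (k' + 1), ?_⟩
    rw [hcard, pow_succ, Nat.mul_div_cancel _ (by norm_num : 0 < 2), pow_succ]
    ring
  have h := fibreTwo_add_two_eq_card_block_add_indexTwoRank c hc2 hc1 hcen heven
  rw [show Fintype.card (Block c) + indexTwoRank (stabGen c) - 2 = fibreTwo c hc2 by omega]
  exact isLeast_card_gfaces_generate_fibreTwo_of_two_group hc2 hc1 hcen u hcard hk hindex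

end

end Summit.HodgeConjecture.CorCM.Census.IndexTwoCyclic
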